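import Mathlib
import Summits.KontsevichZagierPeriods.Zeta5Search.BrickTopKummer
import Summits.KontsevichZagierPeriods.Zeta5Search.BrickPhiCoeff

/-!
# BrickDigitStepD — THEOREM 5/6 Step D and PLAN-T7 L7.7 (first display): the DIGIT CELLS REDUCE TO THEIR `m = 0`
TERM modulo `p³`: `D^{(s)}_j ≡ p^{Lτ_s}·(Φ_{n,p}(−j) − 1)·c_{j,s}(n) (mod p³)` at every level `L` (cell zeta5-irr)

HONEST FRAMING: systematic search; no irrationality claim unless certified. INSTRUMENT lemma of the ζ(5)
census cell zeta5-irr (HOME `run/shared/lean/pub/zeta5-irr/`; memo `zi-p2/probes/B8/thm6/THEOREM6.md` Step D: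
«For `s ≥ 1`, by (B1), `D_j^{(s)} = p^{τ_s}(Φ(−j)−1)c_{j,s}(n) + Σ_{m=1}^{A−s}φ_m·p^{τ_s}c_{j,s+m}(n)`, and for
`m ≥ 1`: `v(φ_m) ≥ 3` (A2), `v(p^{τ_s}c_{j,s+m}(n)) ≥ m − 1 + ṽ_j ≥ 0` (C2⁺); so `D_j^{(s)} ≡ p^{τ_s}(Φ(−j)−1)c_{j,s}(n)
(mod p³)» (D1); `zi-p2/probes/B8/thm7-plan/PLAN-T7.md` L7.7 «`D_j^{(s)} = p^{2τ_s}[(Φ(−j)−1)c_{j,s}(n) +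
Σ_{m≥1}φ_mc_{j,s+m}(n)]` … Bell terms `≥ 2m+1 ≥ 3`»). Nothing here is about ζ(5); no irrationality content; filing
moves no rung. Filed by the engine seat zi-eng (g8): assembly of `BrickLaurent.cell_frobenius` (B1),
`BrickPhiCoeff` (A2), `BrickTopKummer.cell_one_valuation_abs` (C3⁺ absolute: `p^{L(A−s)}c_{j,s}(n) ∈ ℤ_(p)`).

## The statement

`p ≥ 5` prime, `2B ≤ A`, level `L` (`n < p^{L+1}`), digit index `j ≤ n` (centre included), `s + 1 ≤ A`,
`τ_s := A − 1 − s`, the centred brick kernel `ε = 1` (Ball/Rivoal/Zudilin). The LEVEL-`L` DIGIT DIFFERENCE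

`digitD A B p L n j s := p^{L·τ_s}·(p^{τ_s}·c_{jp,s}(np) − c_{j,s}(n))` (THEOREM 6: `L = 1`, `D_j^{(s)} =
p^{τ_s}(p^{τ_s}cell_{jp}(np) − cell_j(n))`; THEOREM 7: `L = 2`, `p^{3τ_s}cell_{jp}(np) − p^{2τ_s}cell_j(n)`) satisfies

* `pow_tau_mul_cell_eq_sum` ((B1)/p): `p^{τ_s}·c_{jp,s}(np) = Σ_{m=0}^{A−s} φ_m·c_{j,s+m}(n)`;
* `digitD_eq`: `digitD = p^{Lτ_s}(φ_0 − 1)c_{j,s}(n) + Σ_{m=1}^{A−s} p^{Lτ_s}φ_m c_{j,s+m}(n)`;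
* **`digitD_sub_le` (D1 at level L)**: `v_p(digitD − p^{Lτ_s}(φ_0 − 1)c_{j,s}(n)) ≥ 3` — each Bell term has
  `v ≥ −Lτ_s… + 3 + (−L(A−s−m)) = 3 + L(m−1) ≥ 3`;
* **`digitD_le`**: `v_p(digitD) ≥ 3 − L` (the `m = 0` term: `v(φ_0 − 1) ≥ 3`, `v(p^{Lτ_s}c_{j,s}) ≥ −L`); at `L = 1`
  this is THEOREM 6's «`v(D_j^{(s)}) ≥ 2`».
-/

namespace Summit.KontsevichZagierPeriods.Zeta5Search.BrickDigitStepD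

open Finset Nat WithZero
open Summit.KontsevichZagierPeriods.Zeta5Search.BrickLaurent (cell phiCoeff cell_frobenius)
open Summit.KontsevichZagierPeriods.Zeta5Search.BrickPhiCoeff (padicValuation_phiCoeff_le
  padicValuation_phiCoeff_zero_sub_one_le)
open Summit.KontsevichZagierPeriods.Zeta5Search.BrickTopKummer (cell_one_valuation_abs)

noncomputable section

variable {p : ℕ} [Fact p.Prime]

/-- The level-`L` digit difference `D^{(s),L}_j := p^{L·τ_s}·(p^{τ_s}·c_{jp,s}(np) − c_{j,s}(n))`, `τ_s = A − 1 − s`. -/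
def digitD (A B p L n j s : ℕ) : ℚ :=
  (p : ℚ) ^ (L * (A - 1 - s)) * ((p : ℚ) ^ (A - 1 - s) * cell A B 1 (n * p) (j * p) s - cell A B 1 n j s)

section stepD

variable (h3 : 3 < p) {A B : ℕ} (hAB : 2 * B ≤ A) {L n j s : ℕ} (hn : n < p ^ (L + 1)) (hj : j ≤ n) (hs : s + 1 ≤ A)
include h3 hAB hj hs

/-- **(B1) divided by `p`** (`ε = 1`): `p^{τ_s}·c_{jp,s}(np) = Σ_{m=0}^{A−s} φ_m·c_{j,s+m}(n)`. -/
theorem pow_tau_mul_cell_eq_sum :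
    (p : ℚ) ^ (A - 1 - s) * cell A B 1 (n * p) (j * p) s =
      ∑ m ∈ range (A - s + 1), phiCoeff A B p n j m * cell A B 1 n j (s + m) := by
  have hp : p.Prime := Fact.out
  have hpQ : (p : ℚ) ≠ 0 := by exact_mod_cast hp.ne_zero
  have hp2 : p ≠ 2 := by omega
  have h := cell_frobenius hp hp2 hAB 1 hj s
  have e : (p : ℚ) ^ (A - s) = p * (p : ℚ) ^ (A - 1 - s) := by
    rw [mul_comm, ← pow_succ]; congr 1; omega
  rw [e, pow_one, mul_assoc] at h
  exact mul_left_cancel₀ hpQ h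

/-- `digitD` expanded: `p^{Lτ}(φ_0 − 1)c_{j,s} + Σ_{m=1}^{A−s} p^{Lτ}φ_m c_{j,s+m}` (the tail indexed by `m−1`). -/
theorem digitD_eq : digitD A B p L n j s =
    (p : ℚ) ^ (L * (A - 1 - s)) * (phiCoeff A B p n j 0 - 1) * cell A B 1 n j s +
      ∑ m ∈ range (A - s), (p : ℚ) ^ (L * (A - 1 - s)) * (phiCoeff A B p n j (m + 1) * cell A B 1 n j (s + (m + 1))) := by
  rw [digitD, pow_tau_mul_cell_eq_sum h3 hAB hj hs, Finset.sum_range_succ', ← Finset.mul_sum]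
  simp only [add_zero]
  ring

include hn

/-- **(D1) at level `L`**: `v_p(digitD − p^{Lτ_s}(φ_0 − 1)·c_{j,s}(n)) ≥ 3`. -/
theorem digitD_sub_le :
    Rat.padicValuation p (digitD A B p L n j s - (p : ℚ) ^ (L * (A - 1 - s)) * (phiCoeff A B p n j 0 - 1) * cell A B 1 n j s)
      ≤ exp (-3) := by
  have hp : p.Prime := Fact.out
  rw [digitD_eq h3 hAB hj hs, add_sub_cancel_left]
  refine Valuation.map_sum_le _ fun m hm => ?_
  have hm' := mem_range.1 hm
  rw [map_mul, map_mul, map_pow, Rat.padicValuation_self, ← exp_nsmul, nsmul_eq_mul, mul_neg_one]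
  calc exp (-((L * (A - 1 - s) : ℕ) : ℤ)) *
        (Rat.padicValuation p (phiCoeff A B p n j (m + 1)) * Rat.padicValuation p (cell A B 1 n j (s + (m + 1))))
      ≤ exp (-((L * (A - 1 - s) : ℕ) : ℤ)) * (exp (-3) * exp ((L : ℤ) * (A - (s + (m + 1)) : ℕ))) :=
        mul_le_mul' le_rfl (mul_le_mul' (padicValuation_phiCoeff_le h3 hAB n j (by omega))
          (cell_one_valuation_abs (by omega) hAB hn hj (s + (m + 1))))
    _ ≤ exp (-3) := by
        rw [← exp_add, ← exp_add, exp_le_exp, show A - (s + (m + 1)) = A - 1 - s - m by omega,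
          Nat.cast_sub (show m ≤ A - 1 - s by omega), Nat.cast_mul]
        nlinarith [mul_nonneg (Int.natCast_nonneg L) (Int.natCast_nonneg m)]

/-- **`v_p(digitD) ≥ 3 − L`** (THEOREM 6: `v(D_j^{(s)}) ≥ 2` at `L = 1`): the `m = 0` term has `v(φ_0 − 1) ≥ 3` and
`v(p^{Lτ_s}c_{j,s}(n)) ≥ −L`. -/
theorem digitD_le : Rat.padicValuation p (digitD A B p L n j s) ≤ exp (-3 + (L : ℤ)) := by
  have hp : p.Prime := Fact.out
  have hmain := digitD_sub_le h3 hAB hn hj hs (L := L)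
  have h0 : Rat.padicValuation p ((p : ℚ) ^ (L * (A - 1 - s)) * (phiCoeff A B p n j 0 - 1) * cell A B 1 n j s)
      ≤ exp (-3 + (L : ℤ)) := by
    rw [map_mul, map_mul, map_pow, Rat.padicValuation_self, ← exp_nsmul, nsmul_eq_mul, mul_neg_one]
    calc exp (-((L * (A - 1 - s) : ℕ) : ℤ)) * Rat.padicValuation p (phiCoeff A B p n j 0 - 1) *
          Rat.padicValuation p (cell A B 1 n j s)
        ≤ exp (-((L * (A - 1 - s) : ℕ) : ℤ)) * exp (-3) * exp ((L : ℤ) * (A - s : ℕ)) :=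
          mul_le_mul' (mul_le_mul' le_rfl (padicValuation_phiCoeff_zero_sub_one_le h3 hAB n j))
            (cell_one_valuation_abs (by omega) hAB hn hj s)
      _ = exp (-3 + (L : ℤ)) := by
          rw [← exp_add, ← exp_add, show A - s = A - 1 - s + 1 by omega, Nat.cast_mul, Nat.cast_succ]; congr 1; ring
  have hsum : digitD A B p L n j s = (digitD A B p L n j s -
      (p : ℚ) ^ (L * (A - 1 - s)) * (phiCoeff A B p n j 0 - 1) * cell A B 1 n j s) +
      (p : ℚ) ^ (L * (A - 1 - s)) * (phiCoeff A B p n j 0 - 1) * cell A B 1 n j s := by ring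
  rw [hsum]
  exact (Valuation.map_add _ _ _).trans (max_le (hmain.trans (exp_le_exp.2 (by omega))) h0)

end stepD

end

end Summit.KontsevichZagierPeriods.Zeta5Search.BrickDigitStepD
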